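import Summits.BirchSwinnertonDyer.BirchSwinnertonDyer.Theorems.EisensteinPrimesResidualDevissageNonsplitLambdaIdentityAtNonsplit
import Literature.NumberTheory.EllipticCurves.TateCurve.NumberFieldUniformization
import HarnessLib

/-!
# At a SPLIT multiplicative Eisenstein prime EVERY `Γ_K`-stable line of `E_K[p]` is ANOMALOUS at `v̄`: `D_v̄` fixes the line pointwise
# or acts trivially on its quotient — so one member of every residual pair VIOLATES CGLS Prop. 1.2.5's «`θ|_{G_v̄} ≠ 𝟙`»
# (cell `bsd-eis`, width seat `bsd-line-x2-p2` gen 9; crux 4 `BSDpOnCellC` stmt-BirchSwinnertonDyer-19034, line b1 v12 — the SPLIT conjunct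
# of the wall `stub_imprimitiveCount`; skeleton of record 155e218d… UNCHANGED, W-79)

WHY. The wall `stub_imprimitiveCount` of line b1 has two conjuncts. After this seat's p664472–p668130 the NON-SPLIT one is a tree
theorem from TEN published facts + [BR𝟙] + two inline statements, ALL running through CGLS 2022 §1.2's hypothesis «`θ|_{G_v̄} ∉ {𝟙, ω}`»
for BOTH residual characters (g6's `localData_of_not_split` / `charHypotheses_of_not_split`). This file records, in the kernel and in the
same currencies, WHY that road is closed at a SPLIT multiplicative prime and WHAT the split conjunct's starting datum is
(Keller–Yin's anomalous Cases I–III, Greenberg–Vatsal §2: `E[p^∞]|_{G_p}` is `0 → μ_{p^∞} → · → ℚ_p/ℤ_p → 0` with TRIVIAL action on the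
quotient):

* §1 `fix_or_quot_of_split_of_mem_primesAbove` — the b2b cell's `X2.TateLineDecomposition.fix_or_quot_of_split` («SPLIT odd `p ‖ N`: `D_v`
  fixes a stable line or acts trivially on the quotient», granted the Tate uniformisation — a tree THEOREM,
  `TateCurve.Silverman1994_thmV53_tateUniformisation_holds`) moved from the CHOSEN prime above `p` to EVERY prime `𝔓 ∣ p` of `\bar ℤ`
  (conjugate the line by `σ` with `𝔓 = σ•𝔓₀`; g6's §1 pattern);
* §2 `localData_of_split` — for `E_K = W_K` over an imaginary quadratic `K` with `(p)` split, `v̄ ∋ p`, and ANY `Γ_K`-stable `S ≤ E_K[p]` of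
  order `p`: `#(E_K[p]/S) = p`, and EITHER `D_{v̄}` fixes `S` pointwise AND acts on `E_K[p]/S` through the mod-`p` cyclotomic character,
  OR `D_{v̄}` acts on `S` through the cyclotomic character AND trivially on `E_K[p]/S` (the CHL degree-one transport `…LineBaseChange` read
  positively; the cyclotomic clauses by `det = ω`: CHL's `smul_quot_eq_cyclotomic_of_smul_sub_eq` and §0's fourth reading
  `smul_sub_eq_cyclotomic_of_smul_quot_eq`);
* §3 `charHypotheses_of_split` — for every residual pair `(θsub, θquot)` of `E_K[p]` at a SPLIT multiplicative datum:
  `(θsub, θquot)|_{G_v̄} ∈ {(𝟙, ω), (ω, 𝟙)}` on the residual modules — the NEGATION of the binders `hne1`/`hneω` under which every character-level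
  fact of the non-split chain (`prop125_characterGrSelmerDual_*`, `prop14_*`, `cor126_*`) is stated: the split conjunct needs the
  ANOMALOUS theory (Keller–Yin Thm. 1.4.1 (iii) / §1.3 Cases I–III; the x1 cell's V20/V21 road), and §2 is its first brick.

HONEST FRAMING: theorems only (no `def`, no named fact, no `sorry`); UNCONDITIONAL (both Tate uniformisations are tree theorems); closes no
stub; skeleton of record unchanged (W-79); BSD / Mazur's MC / IMC proved for no curve; 0 cells / labels / tiers move.

References: [GreenbergVatsal2000] §2 pp. 14–15 (`C ≅ μ_{p^∞}`, `D = A/C ≅ ℚ_p/ℤ_p` trivial at a split prime); [SilvermanATAEC1994] Ch. V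
Thm. 3.1 (c),(d), Thm. 5.3 (a),(b); [KellerYin2024] §1.3 Prop. 1.3.1 (Cases I–III), Thm. 1.4.1 (iii), §5 (arXiv:2402.12781v2);
[CastellaGrossiLeeSkinner2022] §1.2 (hypothesis θ|_{G_v̄} ≠ 𝟙, ω); [NeukirchANT1999] Ch. I §9 (9.4)–(9.6), Ch. II §9 (9.6); [Serre1972] §1.11;
cell files: b2b `X2/TateLineDecomposition` (`fix_or_quot_of_split`), CHL `…LineBaseChange` / `…LineDeterminant`, g6 p642385/p643997
(`localData_of_not_split`), x1-p1-w2 `ResidualLineRigidity`.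
-/

set_option autoImplicit false
set_option linter.dupNamespace false -- the summit namespace `…BirchSwinnertonDyer.BirchSwinnertonDyer.Theorems` (Sub = Summit, D-0017) trips it

noncomputable section

open scoped Classical Pointwise

namespace Summit.BirchSwinnertonDyer.BirchSwinnertonDyer.Theorems.ResidualDevissageSplitLocalData

open WeierstrassCurve NumberField IsDedekindDomain Field
  Literature.NumberTheory.EllipticCurves Literature.NumberTheory.EllipticCurves.IwasawaAlgebra
  Literature.NumberTheory.EllipticCurves.GreenbergSelmer
  Literature.NumberTheory.EllipticCurves.GreenbergVatsal2000
  Literature.NumberTheory.GaloisRepresentations IsDedekindDomain.HeightOneSpectrum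
  Literature.NumberTheory.EllipticCurves.Rank1Residual Literature.NumberTheory.EllipticCurves.KellerYin2024
  Summit.BirchSwinnertonDyer.Rank1Residual.X11b Summit.BirchSwinnertonDyer.Rank1Residual.X11b.AcSelmer
  Summit.BirchSwinnertonDyer.Rank1Residual.X2.ResidualDevissageModules
  Summit.BirchSwinnertonDyer.BirchSwinnertonDyer.Theorems
  Summit.BirchSwinnertonDyer.BirchSwinnertonDyer.Theorems.ResidualDevissageNonsplitLocalData
  Summit.BirchSwinnertonDyer.BirchSwinnertonDyer.Theorems.ResidualDevissageNonsplitLambdaIdentityOfFacts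
  Summit.BirchSwinnertonDyer.BirchSwinnertonDyer.Theorems.ResidualDevissageNonsplitLambdaIdentityAtNonsplit
  Summit.BirchSwinnertonDyer.BirchSwinnertonDyer.Theorems.CumulativeHeegnerInclusionAtThreeResidualDevissage
  Summit.BirchSwinnertonDyer.BirchSwinnertonDyer.Theorems.CumulativeHeegnerInclusionAtThreeLineBaseChange
  Summit.BirchSwinnertonDyer.BirchSwinnertonDyer.Theorems.CumulativeHeegnerInclusionAtThreeTowerFixed
  Summit.BirchSwinnertonDyer.BirchSwinnertonDyer.Theorems.CumulativeHeegnerInclusionAtThreeStubB1LineDeterminant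
  Summit.BirchSwinnertonDyer.BirchSwinnertonDyer.Theorems.CumulativeHeegnerInclusionAtThreeBadPlaces
  Summit.BirchSwinnertonDyer.BirchSwinnertonDyer.Theorems.AdditiveKoly.SplitCompletion
  Summit.BirchSwinnertonDyer.BirchSwinnertonDyer.Theorems.KellerYinLemma511NonsplitOfPrint

/-! ### §0 `det = ω` read from the quotient: `g` trivial on `E[p]/S` ⟹ `g` acts on `S` by `ω(g)` -/

/-- **`g` acts trivially on `E[p]/Φ` ⟹ `g` acts on `Φ` by `ω(g)`** (`ψ(g) = 1 ⟹ φ(g) = ω(g)`; `Φ ≤ E[p]` a `Γ_K`-stable line): the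
fourth reading of `det ρ̄ = ω` next to CHL's `smul_quot_eq_cyclotomic_of_smul_sub_eq`, `smul_quot_eq_of_smul_sub_eq_cyclotomic`,
`smul_sub_eq_of_smul_quot_eq_cyclotomic`. Proof: `g` acts on the cyclic line by some `k` (`exists_zsmul_eq_of_ne_zero`), hence on the quotient
by `k'` with `k k' = ω(g)` (`smul_sub_nsmul_mem_of_smul_sub_eq`); triviality on the quotient of order `p` forces `k' ≡ 1`, so `k ≡ ω(g)`.
[cite: SilvermanCSS1997, Ch. II §7–§8 (det ρ̄ = χ)] [cite: CastellaGrossiLeeSkinner2022, §1.4 (ψ = ωφ⁻¹)] -/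
theorem smul_sub_eq_cyclotomic_of_smul_quot_eq {K : Type} [Field K] [NumberField K] (X : WeierstrassCurve K) [X.IsElliptic]
    (p : ℕ) [hp : Fact p.Prime] (S : StableSubgroup (absoluteGaloisGroup K) (X.geomTorsion (p : ℤ))) (hS : Nat.card S.Sub = p)
    (hQ : Nat.card S.Quot = p) (g : absoluteGaloisGroup K) (hq : ∀ q : S.Quot, g • q = q) (m : S.Sub) :
    g • m = ((modNCyclotomicCharacter K p g : (ZMod p)ˣ) : ZMod p).val • m := by
  have hpr : p.Prime := hp.out
  by_cases hm0 : m = 0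
  · rw [hm0, smul_zero, smul_zero]
  -- `m` generates the line; `g • m = z • m = k • m` with `k = (z mod p).val`
  obtain ⟨hpm, hgen⟩ := exists_zsmul_eq_of_ne_zero X p S hS hm0
  obtain ⟨z, hz⟩ := hgen (g • m)
  obtain ⟨k, hk⟩ : ∃ k : ℕ, k = (z : ZMod p).val := ⟨_, rfl⟩
  have hklt : k < p := by rw [hk]; exact ZMod.val_lt _
  have hkz : ((k : ℕ) : ZMod p) = (z : ZMod p) := by rw [hk, ZMod.natCast_zmod_val]
  have hzk : (z : ℤ) • m = (k : ℕ) • m := by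
    have hdvd : (p : ℤ) ∣ z - k := by
      rw [← ZMod.intCast_zmod_eq_zero_iff_dvd]; push_cast; rw [hkz, sub_self]
    obtain ⟨c, hc⟩ := hdvd
    have hpm' : (p : ℤ) • m = 0 := by rw [natCast_zsmul]; exact hpm
    have e : z = (k : ℤ) + (p : ℤ) * c := by linear_combination hc
    rw [e, add_zsmul, mul_comm, mul_zsmul, hpm', zsmul_zero, add_zero, natCast_zsmul]
  have hgm : g • m = k • m := by rw [hz, hzk]
  have hkS : ∀ m' : S.Sub, g • m' = k • m' := fun m' ↦ by
    obtain ⟨w, rfl⟩ := hgen m'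
    rw [smul_comm g w m, hgm, smul_comm k w m]
  -- `k ≢ 0`: `g` is injective on the line
  have hk0 : ((k : ℕ) : ZMod p) ≠ 0 := by
    intro h0
    have hk00 : k = 0 := Nat.eq_zero_of_dvd_of_lt ((ZMod.natCast_eq_zero_iff k p).mp h0) hklt
    apply hm0
    have h1 : g • m = 0 := by rw [hgm, hk00, zero_smul]
    have h2 := congrArg (g⁻¹ • ·) h1
    simpa only [inv_smul_smul, smul_zero] using h2
  -- the quotient scalar `k'` with `k k' = ω(g)`
  set ω : ZMod p := ((modNCyclotomicCharacter K p g : (ZMod p)ˣ) : ZMod p) with hωdef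
  obtain ⟨k', hk'⟩ : ∃ k' : ℕ, k' = (ω * ((k : ℕ) : ZMod p)⁻¹).val := ⟨_, rfl⟩
  have hkk' : ((k : ℕ) : ZMod p) * ((k' : ℕ) : ZMod p) = ω := by
    have e : ((k' : ℕ) : ZMod p) = ω * ((k : ℕ) : ZMod p)⁻¹ := by rw [hk', ZMod.natCast_zmod_val]
    rw [e, mul_comm, inv_mul_cancel_right₀ hk0]
  have hquot : ∀ q : S.Quot, g • q = k' • q := fun q ↦ by
    obtain ⟨P, rfl⟩ := S.proj_surjective q
    rw [S.smul_proj, ← map_nsmul, ← sub_eq_zero, ← map_sub, ← AddMonoidHom.mem_ker, S.ker_proj]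
    exact smul_sub_nsmul_mem_of_smul_sub_eq X p S hS g k k' hkk' hkS P
  -- `k' ≡ 1`: the quotient has order `p` and `g` is trivial on it
  have hk'1 : ((k' : ℕ) : ZMod p) = 1 := by
    haveI : Finite S.Quot := Nat.finite_of_card_ne_zero (by rw [hQ]; exact hpr.ne_zero)
    have h1Q : 1 < Nat.card S.Quot := by rw [hQ]; exact hpr.one_lt
    haveI : Nontrivial S.Quot := Finite.one_lt_card_iff_nontrivial.mp h1Q
    obtain ⟨q₀, hq₀⟩ := exists_ne (0 : S.Quot)
    have hord : addOrderOf q₀ = p := by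
      have hdvd : addOrderOf q₀ ∣ Nat.card S.Quot := addOrderOf_dvd_natCard q₀
      rw [hQ] at hdvd
      rcases (Nat.dvd_prime hpr).mp hdvd with h1 | h1
      · exact absurd (AddMonoid.addOrderOf_eq_one_iff.mp h1) hq₀
      · exact h1
    have hq1 : (k' : ℤ) • q₀ = q₀ := by rw [natCast_zsmul, ← hquot q₀, hq q₀]
    have hfix : ((k' : ℤ) - 1) • q₀ = 0 := by rw [sub_zsmul, one_zsmul, hq1, add_neg_cancel]
    have hdvd : (p : ℤ) ∣ (k' : ℤ) - 1 := by
      rw [← hord]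
      exact addOrderOf_dvd_iff_zsmul_eq_zero.mpr hfix
    have h := (ZMod.intCast_zmod_eq_zero_iff_dvd _ p).mpr hdvd
    push_cast at h
    exact sub_eq_zero.mp h
  -- hence `k ≡ ω(g)` and `g • m = ω(g).val • m`
  have hkω : ((k : ℕ) : ZMod p) = ω := by rw [← hkk', hk'1, mul_one]
  have hval : ω.val = k := by rw [← hkω, ZMod.val_natCast, Nat.mod_eq_of_lt hklt]
  rw [hval, hgm]

/-! ### §1 SPLIT `p`: at EVERY prime above `p`, the decomposition group fixes a stable line or acts trivially on its quotient -/

/-- **SPLIT multiplicative `p`, every prime `𝔓 ∣ p` of `\bar ℤ`**: for a subgroup `Φ ≤ E₀[p](ℚ̄)` of order `p` stable under the decomposition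
group `D_𝔓 ≤ Γ_ℚ`, EITHER `D_𝔓` fixes `Φ` pointwise OR `D_𝔓` acts trivially on `E₀[p]/Φ` («`φ|_{G_p} ∈ {𝟙, ω}`»). The b2b cell's
`X2.TateLineDecomposition.fix_or_quot_of_split` at the chosen prime `𝔓₀` (the Tate datum `C ≅ μ_{p^∞}` with `D_v` TRIVIAL on `E₀[p^∞]/C`,
Greenberg–Vatsal §2; uniformisation = tree theorem `TateCurve.Silverman1994_thmV53_tateUniformisation_holds`) applied to the `D_{𝔓₀}`-stable
line `σ⁻¹Φ` when `𝔓 = σ𝔓₀`. UNCONDITIONAL. [cite: GreenbergVatsal2000, §2 pp. 14–15] [cite: SilvermanATAEC1994, Ch. V Thm. 3.1 (c),(d), Thm. 5.3 (a),(b)]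
[cite: NeukirchANT1999, Ch. I §9 (9.6)] -/
theorem fix_or_quot_of_split_of_mem_primesAbove
    (W : WeierstrassCurve ℚ) [W.IsElliptic] [W.IsGloballyMinimal] (p : ℕ) [Fact p.Prime]
    (hsplit : W.HasSplitMultiplicativeReductionAtPrime p)
    {v : HeightOneSpectrum (𝓞 ℚ)} (hpv : ((p : ℕ) : 𝓞 ℚ) ∈ v.asIdeal)
    {Φ : AddSubgroup (geomTorsion W (p : ℤ))} (hΦ : Nat.card Φ = p)
    {𝔓 : Ideal (absIntegers (𝓞 ℚ) ℚ)} (h𝔓 : 𝔓 ∈ v.primesAbove)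
    (hΦst : ∀ g ∈ 𝔓.decompositionSubgroup (absoluteGaloisGroup ℚ), ∀ P ∈ Φ, g • P ∈ Φ) :
    (∀ g ∈ 𝔓.decompositionSubgroup (absoluteGaloisGroup ℚ), ∀ P ∈ Φ, g • P = P) ∨
      (∀ g ∈ 𝔓.decompositionSubgroup (absoluteGaloisGroup ℚ), ∀ P : geomTorsion W (p : ℤ), g • P - P ∈ Φ) := by
  -- `𝔓 = σ • 𝔓₀` with `𝔓₀` the chosen prime above `v`, `D_{𝔓₀} = decomp v`
  obtain ⟨σ, hσ⟩ := IsDedekindDomain.HeightOneSpectrum.exists_smul_eq_of_mem_primesAbove_holds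
    (adicCompletionPrime_mem_primesAbove ℚ v) h𝔓
  have hconj : ∀ g ∈ decomp (K := ℚ) v, σ * g * σ⁻¹ ∈ 𝔓.decompositionSubgroup (absoluteGaloisGroup ℚ) := by
    intro g hg
    have hg' : g ∈ (adicCompletionPrime ℚ v).decompositionSubgroup (absoluteGaloisGroup ℚ) := by
      rw [decompositionSubgroup_adicCompletionPrime_eq_range]; exact hg
    rw [← hσ, Ideal.decompositionSubgroup_smul]
    have := Subgroup.smul_mem_pointwise_smul g (MulAut.conj σ) _ hg'
    simpa only [MulAut.smul_def, MulAut.conj_apply] using this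
  have hconj' : ∀ g ∈ 𝔓.decompositionSubgroup (absoluteGaloisGroup ℚ), σ⁻¹ * g * σ ∈ decomp (K := ℚ) v := by
    intro g hg
    rw [← hσ, Ideal.decompositionSubgroup_smul, Subgroup.mem_pointwise_smul_iff_inv_smul_mem, MulAut.smul_def,
      MulAut.conj_inv_apply, decompositionSubgroup_adicCompletionPrime_eq_range] at hg
    exact hg
  -- the conjugated line `Φ' = σ⁻¹ Φ`, of order `p`, stable under `D_{𝔓₀}`
  let f := DistribSMul.toAddMonoidHom (geomTorsion W (p : ℤ)) σ⁻¹
  have hΦ' : Nat.card (Φ.map f) = p := ResidualLineRigidity.natCard_map_eq σ⁻¹ hΦ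
  have hΦ'st : ∀ g ∈ decomp (K := ℚ) v, ∀ P' ∈ Φ.map f, g • P' ∈ Φ.map f := by
    intro g hg P' hP'
    obtain ⟨P, hP, rfl⟩ := AddSubgroup.mem_map.mp hP'
    refine AddSubgroup.mem_map.mpr ⟨(σ * g * σ⁻¹) • P, hΦst _ (hconj g hg) P hP, ?_⟩
    change σ⁻¹ • ((σ * g * σ⁻¹) • P) = g • (σ⁻¹ • P)
    rw [mul_smul, mul_smul, inv_smul_smul]
  rcases Summit.BirchSwinnertonDyer.Rank1Residual.X2.TateLineDecomposition.fix_or_quot_of_split W p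
      TateCurve.Silverman1994_thmV53_tateUniformisation_holds hsplit hpv hΦ' hΦ'st with hfix | hquot
  · refine Or.inl fun g hg P hP ↦ ?_
    -- `σ⁻¹ g σ` fixes `σ⁻¹ • P ∈ Φ'`
    have h' := hfix _ (hconj' g hg) (σ⁻¹ • P) (AddSubgroup.mem_map.mpr ⟨P, hP, rfl⟩)
    rw [mul_smul, mul_smul] at h'
    have h'' := congrArg (σ • ·) h'
    simpa only [smul_inv_smul] using h''
  · refine Or.inr fun g hg P ↦ ?_
    -- `(σ⁻¹ g σ) • P' - P' ∈ Φ'` for `P' = σ⁻¹ • P`, hence `g • P - P ∈ σ Φ' = Φ`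
    have h' := hquot _ (hconj' g hg) (σ⁻¹ • P)
    obtain ⟨R, hR, hR'⟩ := AddSubgroup.mem_map.mp h'
    change σ⁻¹ • R = (σ⁻¹ * g * σ) • (σ⁻¹ • P) - σ⁻¹ • P at hR'
    rw [mul_smul, mul_smul, smul_inv_smul, ← smul_sub] at hR'
    have h'' := congrArg (σ • ·) hR'
    simp only [smul_inv_smul] at h''
    rw [← h'']
    exact hR

/-! ### §2 The local data at `v̄` of ANY `Γ_K`-stable line of `E_K[p]` at a SPLIT multiplicative prime -/

/-- **Every `Γ_K`-stable line of `E_K[p]` at a SPLIT multiplicative prime is ANOMALOUS at `v̄`** (`K` imaginary quadratic, `(p)` split,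
`v̄ ∋ p`; `S ≤ E_K[p]` any `Γ_K`-stable subgroup of order `p`): `#(E_K[p]/S) = p`, and EITHER `D_{v̄}` fixes `S` pointwise and acts on
`E_K[p]/S` through the mod-`p` cyclotomic character («`(φ, ψ)|_{G_v̄} = (𝟙, ω)`»), OR `D_{v̄}` acts on `S` through the mod-`p` cyclotomic
character and trivially on `E_K[p]/S` («`(φ, ψ)|_{G_v̄} = (ω, 𝟙)`»). §1 for the line `t⁻¹(S) ≤ E[p](ℚ̄)` along an equivariant
`t : E[p](ℚ̄) ≅ E_K[p](K̄)` at the prime of `\bar ℤ` under the chosen prime of `v̄` (its decomposition group stabilises `t⁻¹(S)`: CHL's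
degree-one lemma `decompositionSubgroup_le_of_decomp_le` applied to the open setwise stabiliser), read back on `decomp v̄`
(`comap_decompositionSubgroup_comap_absIntegersMap`), and `det = ω` (`smul_quot_eq_cyclotomic_of_smul_sub_eq`, §0). UNCONDITIONAL.
The split-prime counterpart of g6's `localData_of_not_split`. [cite: GreenbergVatsal2000, §2 pp. 14–15]
[cite: KellerYin2024, §1.3 Prop. 1.3.1 and Thm. 1.4.1 (iii) (arXiv:2402.12781v2) (the anomalous cases)] [cite: SilvermanATAEC1994, Ch. V Thm. 5.3]
[cite: NeukirchANT1999, Ch. I §9 Prop. (9.4)–(9.6)] -/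
theorem localData_of_split
    {p : ℕ} [hp : Fact p.Prime] (W : WeierstrassCurve ℚ) [W.IsElliptic] [W.IsGloballyMinimal]
    (K : Type) [Field K] [NumberField K] (vbar : HeightOneSpectrum (𝓞 K))
    (hsplitred : W.HasSplitMultiplicativeReductionAtPrime p) (hK : IsImaginaryQuadratic K)
    (hsplit : ((Ideal.span {(p : ℤ)}).primesOver (𝓞 K)).ncard = 2)
    (hvbar : ((p : ℕ) : 𝓞 K) ∈ vbar.asIdeal)
    (S : StableSubgroup (absoluteGaloisGroup K) ((W.baseChange K).geomTorsion ((p : ℕ) : ℤ)))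
    (hSub : Nat.card S.Sub = p) :
    Nat.card S.Quot = p ∧
      (((∀ g ∈ decomp vbar, ∀ x : S.Sub, g • x = x) ∧
        (∀ g ∈ decomp vbar, ∀ y : S.Quot, g • y = ((modNCyclotomicCharacter K p g : (ZMod p)ˣ) : ZMod p).val • y)) ∨
       ((∀ g ∈ decomp vbar, ∀ x : S.Sub, g • x = ((modNCyclotomicCharacter K p g : (ZMod p)ˣ) : ZMod p).val • x) ∧
        (∀ g ∈ decomp vbar, ∀ y : S.Quot, g • y = y))) := by
  have hpp : p.Prime := hp.out
  haveI hEK : (W.baseChange K).IsElliptic := inferInstanceAs (W.map (algebraMap ℚ K)).IsElliptic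
  haveI : IsGalois ℚ K := isGalois_of_finrank_eq_two K hK.1
  have he : vbar.asIdeal.ramificationIdx (𝓞 ℚ) = 1 := ramificationIdx_eq_one_of_card_primesOver K p hK.1 hsplit vbar hvbar
  have hf : vbar.asIdeal.inertiaDeg (𝓞 ℚ) = 1 := inertiaDeg_eq_one_of_card_primesOver K p hK.1 hsplit vbar hvbar
  set v : HeightOneSpectrum (𝓞 ℚ) := vbar.under (𝓞 ℚ) with hv
  have hw : vbar.asIdeal.under (𝓞 ℚ) = v.asIdeal := by rw [hv, HeightOneSpectrum.under_asIdeal]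
  have hpv : ((p : ℕ) : 𝓞 ℚ) ∈ v.asIdeal := natCast_mem_under K p vbar hvbar
  -- the line `Φ = t⁻¹(S)` over `ℚ̄`
  obtain ⟨t, ht⟩ := exists_geomTorsion_baseChange_equiv W K ((p : ℕ) : ℤ)
  have ht' : ∀ (σ : absoluteGaloisGroup K) (P : W.geomTorsion ((p : ℕ) : ℤ)),
      t (absGaloisRestrict ℚ K σ • P) = σ • t P := fun σ P ↦ by
    rw [← resGal_eq_absGaloisRestrict]; exact ht σ P
  let Φ : AddSubgroup (W.geomTorsion ((p : ℕ) : ℤ)) := S.toAddSubgroup.comap t.toAddMonoidHom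
  have hS : ∀ Q : (W.baseChange K).geomTorsion ((p : ℕ) : ℤ), Q ∈ S.toAddSubgroup ↔ t.symm Q ∈ Φ := fun Q ↦ by
    change Q ∈ S.toAddSubgroup ↔ t (t.symm Q) ∈ S.toAddSubgroup
    rw [t.apply_symm_apply]
  have hΦmem : ∀ P : W.geomTorsion ((p : ℕ) : ℤ), P ∈ Φ ↔ t P ∈ S.toAddSubgroup := fun _ ↦ Iff.rfl
  have hΦcard : Nat.card Φ = p := by
    have e : Φ ≃ S.toAddSubgroup :=
      { toFun := fun x ↦ ⟨t x.1, x.2⟩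
        invFun := fun y ↦ ⟨t.symm y.1, by
          change t (t.symm y.1) ∈ S.toAddSubgroup
          rw [t.apply_symm_apply]; exact y.2⟩
        left_inv := fun x ↦ Subtype.ext (t.symm_apply_apply x.1)
        right_inv := fun y ↦ Subtype.ext (t.apply_symm_apply y.1) }
    have h : Nat.card Φ = Nat.card S.Sub := Nat.card_congr e
    exact h.trans hSub
  -- `Φ` is stable under `res(Γ_K)`, hence under `D_𝔓` for the prime `𝔓` under the chosen prime of `v̄` (degree-one transport)
  have hresst : ∀ (γ : absoluteGaloisGroup K), ∀ P ∈ Φ, absGaloisRestrict ℚ K γ • P ∈ Φ := fun γ P hP ↦ by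
    rw [hΦmem, ht']
    exact S.smul_mem' γ ((hΦmem P).mp hP)
  -- the setwise stabiliser of `Φ`, an open subgroup of `Γ_ℚ`
  let T : Subgroup (absoluteGaloisGroup ℚ) :=
    { carrier := {g | Φ.map (DistribSMul.toAddMonoidHom (W.geomTorsion ((p : ℕ) : ℤ)) g) = Φ}
      mul_mem' := fun {a b} ha hb ↦ by
        change Φ.map (DistribSMul.toAddMonoidHom _ (a * b)) = Φ
        have e : DistribSMul.toAddMonoidHom (W.geomTorsion ((p : ℕ) : ℤ)) (a * b) =
            (DistribSMul.toAddMonoidHom _ a).comp (DistribSMul.toAddMonoidHom _ b) :=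
          AddMonoidHom.ext fun P ↦ mul_smul a b P
        rw [e, ← AddSubgroup.map_map]
        change Φ.map (DistribSMul.toAddMonoidHom _ b) = Φ at hb
        change Φ.map (DistribSMul.toAddMonoidHom _ a) = Φ at ha
        rw [hb, ha]
      one_mem' := by
        change Φ.map (DistribSMul.toAddMonoidHom _ (1 : absoluteGaloisGroup ℚ)) = Φ
        have e : DistribSMul.toAddMonoidHom (W.geomTorsion ((p : ℕ) : ℤ)) (1 : absoluteGaloisGroup ℚ) = AddMonoidHom.id _ :=
          AddMonoidHom.ext fun P ↦ one_smul _ P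
        rw [e, AddSubgroup.map_id]
      inv_mem' := fun {a} ha ↦ by
        change Φ.map (DistribSMul.toAddMonoidHom _ a) = Φ at ha
        change Φ.map (DistribSMul.toAddMonoidHom _ a⁻¹) = Φ
        have e : (DistribSMul.toAddMonoidHom (W.geomTorsion ((p : ℕ) : ℤ)) a⁻¹).comp (DistribSMul.toAddMonoidHom _ a) =
            AddMonoidHom.id _ :=
          AddMonoidHom.ext fun P ↦ inv_smul_smul a P
        conv_lhs => rw [← ha, AddSubgroup.map_map, e, AddSubgroup.map_id] }
  have hTmem : ∀ g : absoluteGaloisGroup ℚ, g ∈ T ↔ Φ.map (DistribSMul.toAddMonoidHom (W.geomTorsion ((p : ℕ) : ℤ)) g) = Φ :=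
    fun _ ↦ Iff.rfl
  have hTst : ∀ g ∈ T, ∀ P ∈ Φ, g • P ∈ Φ := fun g hg P hP ↦ by
    rw [hTmem] at hg
    rw [← hg]
    exact AddSubgroup.mem_map.mpr ⟨P, hP, rfl⟩
  have hT_of : ∀ g : absoluteGaloisGroup ℚ, (∀ P ∈ Φ, g • P ∈ Φ) → (∀ P ∈ Φ, g⁻¹ • P ∈ Φ) → g ∈ T := fun g h1 h2 ↦ by
    rw [hTmem]
    ext P
    constructor
    · rintro ⟨R, hR, rfl⟩
      exact h1 R hR
    · intro hP
      exact AddSubgroup.mem_map.mpr ⟨g⁻¹ • P, h2 P hP, smul_inv_smul g P⟩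
  have hTopen : IsOpen (T : Set (absoluteGaloisGroup ℚ)) := by
    refine Subgroup.isOpen_mono ?_ (isOpen_iInf_stabilizer_geomTorsion W p)
    intro g hg
    have hgP : ∀ P : W.geomTorsion ((p : ℕ) : ℤ), g • P = P := fun P ↦ by
      have h := (Subgroup.mem_iInf.mp hg) P
      exact Subtype.ext (by rw [AddSubgroup.torsionBy.coe_smul]; exact h)
    refine hT_of g (fun P hP ↦ by rw [hgP P]; exact hP) (fun P hP ↦ ?_)
    have h := hgP (g⁻¹ • P)
    rw [smul_inv_smul] at h
    rw [← h]; exact hP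
  have hle : ∀ γ ∈ decomp vbar, absGaloisRestrict ℚ K γ ∈ T := fun γ _ ↦
    hT_of _ (hresst γ) (fun P hP ↦ by rw [← map_inv]; exact hresst γ⁻¹ P hP)
  set 𝔔 := adicCompletionPrime K vbar with h𝔔def
  have h𝔔 : 𝔔 ∈ vbar.primesAbove := adicCompletionPrime_mem_primesAbove K vbar
  set 𝔓 := 𝔔.comap (absIntegersMap ℚ K) with h𝔓def
  have h𝔓 : 𝔓 ∈ v.primesAbove := comap_absIntegersMap_mem_primesAbove hw h𝔔
  have hDT : 𝔓.decompositionSubgroup (absoluteGaloisGroup ℚ) ≤ T :=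
    decompositionSubgroup_le_of_decomp_le K hw he hf T hTopen hle
  -- `res(decomp v̄) ⊆ D_𝔓`
  have hres : ∀ γ ∈ decomp vbar, absGaloisRestrict ℚ K γ ∈ 𝔓.decompositionSubgroup (absoluteGaloisGroup ℚ) := by
    intro γ hγ
    have hDw : 𝔔.decompositionSubgroup (absoluteGaloisGroup K) = decomp vbar := by
      rw [h𝔔def, decompositionSubgroup_adicCompletionPrime_eq_range]; rfl
    have h : γ ∈ (𝔓.decompositionSubgroup (absoluteGaloisGroup ℚ)).comap (absGaloisRestrict ℚ K).toMonoidHom := by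
      rw [h𝔓def, comap_decompositionSubgroup_comap_absIntegersMap ℚ K 𝔔, hDw]; exact hγ
    exact h
  -- §1 at `𝔓`
  have hΦst : ∀ g ∈ 𝔓.decompositionSubgroup (absoluteGaloisGroup ℚ), ∀ P ∈ Φ, g • P ∈ Φ := fun g hg ↦ hTst g (hDT hg)
  have hEp : Nat.card ((W.baseChange K).geomTorsion ((p : ℕ) : ℤ)) = p ^ 2 := (W.baseChange K).natCard_geomTorsion_prime_eq_sq hpp
  have hQuot : Nat.card S.Quot = p := by
    have h := S.natCard_eq_mul
    rw [hEp, hSub, sq] at h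
    exact (Nat.eq_of_mul_eq_mul_right hpp.pos h).symm
  refine ⟨hQuot, ?_⟩
  rcases fix_or_quot_of_split_of_mem_primesAbove W p hsplitred hpv hΦcard h𝔓 hΦst with hfix | hquot
  · -- `D_{v̄}` fixes `S` pointwise; the quotient clause by `det = ω`
    have hfixK : ∀ γ ∈ decomp vbar, ∀ x : S.Sub, γ • x = x := by
      intro γ hγ x
      apply S.incl_injective
      rw [StableSubgroup.incl_smul]
      have hx : t.symm (S.incl x) ∈ Φ := (hS _).mp (by rw [← S.range_incl]; exact ⟨x, rfl⟩)
      have h1 := hfix _ (hres γ hγ) _ hx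
      have h2 := congrArg t h1
      rw [ht', t.apply_symm_apply] at h2
      exact h2
    exact Or.inl ⟨hfixK, fun γ hγ y ↦ smul_quot_eq_cyclotomic_of_smul_sub_eq (W.baseChange K) p S hSub γ (hfixK γ hγ) y⟩
  · -- `D_{v̄}` acts trivially on `E_K[p]/S`; the line clause by `det = ω` (§0)
    have hquotK : ∀ γ ∈ decomp vbar, ∀ y : S.Quot, γ • y = y :=
      fun γ hγ ↦ (S.forall_smul_quot_eq_self_iff γ).mpr fun Q ↦ by
        have h1 := hquot _ (hres γ hγ) (t.symm Q)
        rw [hΦmem, map_sub, ht', t.apply_symm_apply] at h1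
        exact h1
    exact Or.inr ⟨fun γ hγ x ↦ smul_sub_eq_cyclotomic_of_smul_quot_eq (W.baseChange K) p S hSub hQuot γ (hquotK γ hγ) x,
      hquotK⟩

/-! ### §3 Residual pairs at a SPLIT multiplicative datum violate «`θ|_{G_v̄} ≠ 𝟙`» for one member -/

/-- **At a SPLIT multiplicative Eisenstein datum one member of every residual pair is TRIVIAL at `v̄` on its residual module** (`W/ℚ`
globally minimal, `p` a SPLIT multiplicative prime, `K` imaginary quadratic with `(p)` split, `v̄ ∋ p`, `(θsub, θquot)` a residual pair of
`E_K[p]`): `D_{v̄}` fixes `(F/𝒪)(θsub)[p]` pointwise and acts on `(F/𝒪)(θquot)[p]` through `ω`, OR acts on `(F/𝒪)(θsub)[p]` through `ω` and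
fixes `(F/𝒪)(θquot)[p]` pointwise («`(θsub, θquot)|_{G_v̄} ∈ {(𝟙, ω), (ω, 𝟙)}`») — the NEGATION, for one member each, of the binders `hne1`
(«`θ|_{G_v̄} ≠ 𝟙`») and `hneω` («`θ|_{G_v̄} ≠ ω`») of every character-level fact of the non-split chain (`prop125_characterGrSelmerDual_*`, `prop14_*`, `cor126_*`).
§2 on the pair's stable line (`ResidualPairStableLine.exists_stableLine_of_isResidualPairOver`) read through the equivariant embeddings
(`forall_smul_eq_iff_of_embedding`, `…_cyclotomic_…`). This is WHY the split conjunct of `stub_imprimitiveCount` needs the anomalous theory (KY Cases I–III).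
[cite: CastellaGrossiLeeSkinner2022, §1.2 (hypothesis θ|_{G_v̄} ≠ 𝟙, ω)] [cite: KellerYin2024, §1.3 and Thm. 1.4.1 (iii) (arXiv:2402.12781v2)]
[cite: GreenbergVatsal2000, §2 pp. 14–15] -/
theorem charHypotheses_of_split
    {p : ℕ} [hp : Fact p.Prime] (W : WeierstrassCurve ℚ) [W.IsElliptic] [W.IsGloballyMinimal]
    (K : Type) [Field K] [NumberField K] (vbar : HeightOneSpectrum (𝓞 K))
    (hsplitred : W.HasSplitMultiplicativeReductionAtPrime p) (hK : IsImaginaryQuadratic K)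
    (hsplit : ((Ideal.span {(p : ℤ)}).primesOver (𝓞 K)).ncard = 2)
    (hvbar : ((p : ℕ) : 𝓞 K) ∈ vbar.asIdeal)
    (θsub θquot : FramedGaloisRep K (padicCoeffIntegers (∅ : Set (PadicAlgCl p))) 1)
    (hpair : IsResidualPairOver (W.baseChange K) p θsub θquot) :
    ((∀ g ∈ decomp vbar, ∀ m : charModule (∅ : Set (PadicAlgCl p)) θsub, p • m = 0 → g • m = m) ∧
      (∀ g ∈ decomp vbar, ∀ m : charModule (∅ : Set (PadicAlgCl p)) θquot, p • m = 0 →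
        g • m = ((modNCyclotomicCharacter K p g : (ZMod p)ˣ) : ZMod p).val • m)) ∨
    ((∀ g ∈ decomp vbar, ∀ m : charModule (∅ : Set (PadicAlgCl p)) θsub, p • m = 0 →
        g • m = ((modNCyclotomicCharacter K p g : (ZMod p)ˣ) : ZMod p).val • m) ∧
      (∀ g ∈ decomp vbar, ∀ m : charModule (∅ : Set (PadicAlgCl p)) θquot, p • m = 0 → g • m = m)) := by
  haveI hEK : (W.baseChange K).IsElliptic := inferInstanceAs (W.map (algebraMap ℚ K)).IsElliptic
  obtain ⟨S, hSub, -, ⟨jsub, hjsub, hjsub_inj, hjsub_range⟩, ⟨jquot, hjquot, hjquot_inj, hjquot_range⟩⟩ :=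
    ResidualPairStableLine.exists_stableLine_of_isResidualPairOver (W.baseChange K) hpair
  obtain ⟨-, hcases⟩ := localData_of_split W K vbar hsplitred hK hsplit hvbar S hSub
  rcases hcases with ⟨hfix, hcyc⟩ | ⟨hcyc, hquot⟩
  · exact Or.inl ⟨(forall_smul_eq_iff_of_embedding θsub jsub hjsub hjsub_inj hjsub_range (decomp vbar)).mp hfix,
      (forall_smul_eq_cyclotomic_iff_of_embedding θquot jquot hjquot hjquot_inj hjquot_range (decomp vbar)).mp hcyc⟩
  · exact Or.inr ⟨(forall_smul_eq_cyclotomic_iff_of_embedding θsub jsub hjsub hjsub_inj hjsub_range (decomp vbar)).mp hcyc,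
      (forall_smul_eq_iff_of_embedding θquot jquot hjquot hjquot_inj hjquot_range (decomp vbar)).mp hquot⟩

end Summit.BirchSwinnertonDyer.BirchSwinnertonDyer.Theorems.ResidualDevissageSplitLocalData

end
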